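import Summits.ResolutionOfSingularities.ResolutionOfSingularities.Theorems.PurelyInseparableDim4SwapTransportWindowCoreSigma
import Summits.ResolutionOfSingularities.ResolutionOfSingularities.Theorems.PurelyInseparableDim4SwapTransportWindowFrameSigma
import Summits.ResolutionOfSingularities.ResolutionOfSingularities.Theorems.PurelyInseparableDim4ResConeCInfPinningUSigma
import HarnessLib
import HarnessLib.Audit.Tags

/-!
# Purely inseparable four-folds — ONE STEP OF THE VIRTUAL WINDOW FOR EVERY σ = (n, n) + 0: an honest step of the real twin-slot chain is
# shadowed by the PURE slot step of the virtual straight frame, slot case and rotation case (cell `res-dim4-pi`, K2(p) lane, B-LF (iii-b)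
# class (iii), virtual port 1 ↦ n of the C∞ window, FILE S1 = W4 p715633 with `1 ↦ n`)

[OURS · counted 0 · cell `res-dim4-pi` · K2(p) lane (holder res-dim4-p-12 g5, ruling g5-21 (α)).]  Nothing here proves K2(p) for any `p`, any
TAIL(p, d, 3), `NoIsolatedTrap p p` or resolution of singularities in dimension ≥ 4 / characteristic `p` — NOT proved.  AI kernel work,
weaker than expert review.  A transport lemma about OUR frame; kills nothing by itself.

W4 VERBATIM WITH `1 ↦ n`: C1 (`virtual_core_slot/rotate_sigma0`: the regime-free transport at order `p + n`, precision budget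
`M ≥ Nc + 2p + n + 1`), F1 (`translation_eq_zero_of_frame_sigma0`: σ-(VT-f) free edition + (VT-u) by value, then `frame_step_zero_sigma0`:
the frame at jet `N` passes to the pure child at jet `N − d`) and P1 (`ResCone.cInf_translation_u_eq_zero_sigma0`: (VT-u) from the dead row
and the ROW FLAG — the Q-FLAG input of every `w = 0` class).
* §1 **`virtual_step_slot_sigma0`** — real chart a slot `π λ`; * §2 **`virtual_step_rotate_sigma0`** — real chart a free letter `π g`, the
  virtual partner steps purely in the slot `a`, `π′ = π ∘ (a g)`.
[cite: Hauser2010, §§F–G] [cite: CossartJannsenSaito2020, Thm. 3.14, Lemma 13.2]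
bears_on: LADDER-RESOLUTION:D157-DOOR2 (res-dim4-pi · K2(p) B-LF (iii-b) class (iii) virtual port S1).  Supports
stmt-ResolutionOfSingularities-16155 (helper).
-/

set_option linter.dupNamespace false -- mandated namespace of this single-conjunct summit

noncomputable section

namespace Summit.ResolutionOfSingularities.ResolutionOfSingularities.Theorems.PIDim4

namespace SwapTransport

open MvPolynomial Finset
open Literature.AlgebraicGeometry.Resolution
open Literature.AlgebraicGeometry.Resolution.CentreBlowup
open Literature.AlgebraicGeometry.Resolution.Hauser2010
open Literature.AlgebraicGeometry.Resolution.HauserPerlega2019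

variable {K : Type} [Field K] [DecidableEq K]

/-! ## §1 One window step, slot case, every prime -/

/-- **ONE STEP OF THE VIRTUAL WINDOW — SLOT CASE, every prime, unconditional.**  REAL state `A` (ledger `x_{πλ} x_{πμ}`, order
`d + 2`, `d + 1 = p`) with its honest child `A′ = step p univ (π λ) b A` in the chart of the SLOT `π λ` (isolated with certificate
level `Nc`, order `d + 2`, `e_G = 3`, weights `≤ 1` of total `2`, `x^{r′} ∣ F′`); VIRTUAL framed state `B` (fixed letters `λ μ | u f`:
ledger `x_λ x_μ`, order `d + 2`, `x^r ∣ F`, straight residual `a·x_f^d`, exact pair ledger, dead `ū^{d−2}`-row below `N ≥ d + 4`, flag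
`V ≠ 0`) related to `A` by a slot-unit-class frame `θ` along `π` at precision `M ≥ Nc + 2p + 2` with invertible free block.  THEN
`b (π μ) = 0`, and the PURE slot step `B⁺ := step p univ λ 0 B` is related to `A′` along `π` at precision `M − p` with invertible
free block, framed again at jet `N − d`, isolated with `e_G = 3`. [OURS] [cite: Hauser2010, §§F–G]
[cite: CossartJannsenSaito2020, Thm. 3.14] -/
theorem virtual_step_slot_sigma0 (p : ℕ) [Fact p.Prime] [CharP K p] {n d : ℕ} (hσ : n + d = p) (hn : 0 < n) (hd2 : 2 ≤ d)
    {π : Equiv.Perm (Fin 4)} {la mu u f : Fin 4} (hlm : la ≠ mu) (hlu : la ≠ u) (hlf : la ≠ f) (hmu : mu ≠ u) (hmf : mu ≠ f)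
    (huf : u ≠ f)
    -- the relation at precision `M`
    {A B : State K} {θ e : Fin 4 → MvPolynomial (Fin 4) K} {U E : MvPolynomial (Fin 4) K} {M : ℕ}
    (hθa : θ (π la) = X la * e la) (hθa' : θ (π mu) = X mu * e mu) (hea : constantCoeff (e la) ≠ 0)
    (hea' : constantCoeff (e mu) ≠ 0) (hu0 : constantCoeff (θ (π u)) = 0) (hf0 : constantCoeff (θ (π f)) = 0)
    (hdet : coeff (Finsupp.single u 1) (θ (π u)) * coeff (Finsupp.single f 1) (θ (π f)) -
      coeff (Finsupp.single f 1) (θ (π u)) * coeff (Finsupp.single u 1) (θ (π f)) ≠ 0)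
    (hU : constantCoeff U ≠ 0) (hE : E ∈ originIdeal K ^ M) (hrel : B.F = deletePthPowers p (U ^ p * aeval θ A.F) + E)
    -- the real state and its honest slot step
    (hoA : ordZero A.F = ((p + n : ℕ) : ℕ∞)) (hrA : A.r = Finsupp.single (π la) n + Finsupp.single (π mu) n) {A' : State K}
    {b : Fin 4 → K} (hbj : b (π la) = 0) (hstep : A' = CentreBlowup.step p Finset.univ (π la) b A)
    (hisoA' : IsIsolated p A'.F) {Nc : ℕ} (hcert : originIdeal K ^ Nc ≤ singLocusIdeal p A'.F ⊔ originIdeal K ^ (Nc + 1))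
    (hoA' : ordZero A'.F = ((p + n : ℕ) : ℕ∞)) (he3A' : Module.finrank K (ResCone.resVertex A') = 3)
    (hdegA' : A'.r.degree = 2 * n) (hdivA' : ∀ e ∈ A'.F.support, A'.r ≤ e)
    -- the virtual frame at jet `N`
    (hoB : ordZero B.F = ((p + n : ℕ) : ℕ∞)) (hrB : B.r = Finsupp.single la n + Finsupp.single mu n)
    (hdivB : ∀ e ∈ B.F.support, B.r ≤ e) {a : K} (ha : a ≠ 0) (hformB : ResCone.resForm B = C a * X f ^ d)
    (hledB : ∀ e ∈ B.F.support, e f ≤ d - 1 → n + 1 ≤ e la ∧ n + 1 ≤ e mu) {N eu ef : ℕ} (hef : eu + ef = d - 2) (hN : p + n + 2 ≤ N)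
    (hrowB : ∀ e ∈ B.F.support, e.degree < N → ¬ (e u = eu ∧ e f = ef))
    (hVB : coeff (B.r + (Finsupp.single la 1 + Finsupp.single mu 1 + Finsupp.single u (eu + 1) + Finsupp.single f ef)) B.F ≠ 0)
    (hM : Nc + 2 * p + n + 1 ≤ M) :
    b (π mu) = 0 ∧ A'.r = Finsupp.single (π la) n + Finsupp.single (π mu) n ∧
    ∃ (θ' e' : Fin 4 → MvPolynomial (Fin 4) K) (U' E' : MvPolynomial (Fin 4) K),
      θ' (π la) = X la * e' la ∧ θ' (π mu) = X mu * e' mu ∧ constantCoeff (e' la) ≠ 0 ∧ constantCoeff (e' mu) ≠ 0 ∧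
      constantCoeff (θ' (π u)) = 0 ∧ constantCoeff (θ' (π f)) = 0 ∧
      coeff (Finsupp.single u 1) (θ' (π u)) * coeff (Finsupp.single f 1) (θ' (π f)) -
        coeff (Finsupp.single f 1) (θ' (π u)) * coeff (Finsupp.single u 1) (θ' (π f)) ≠ 0 ∧
      constantCoeff U' ≠ 0 ∧ E' ∈ originIdeal K ^ (M - p) ∧
      (CentreBlowup.step p Finset.univ la 0 B).F = deletePthPowers p (U' ^ p * aeval θ' A'.F) + E' ∧
      -- the frame of the virtual child at jet `N − d`
      ordZero (CentreBlowup.step p Finset.univ la 0 B).F = ((p + n : ℕ) : ℕ∞) ∧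
      (CentreBlowup.step p Finset.univ la 0 B).r = Finsupp.single la n + Finsupp.single mu n ∧
      (∀ e ∈ (CentreBlowup.step p Finset.univ la 0 B).F.support, (CentreBlowup.step p Finset.univ la 0 B).r ≤ e) ∧
      (∃ a' : K, a' ≠ 0 ∧ ResCone.resForm (CentreBlowup.step p Finset.univ la 0 B) = C a' * X f ^ d) ∧
      (∀ e ∈ (CentreBlowup.step p Finset.univ la 0 B).F.support, e f ≤ d - 1 → n + 1 ≤ e la ∧ n + 1 ≤ e mu) ∧
      (∀ e ∈ (CentreBlowup.step p Finset.univ la 0 B).F.support, e.degree < N - d → ¬ (e u = eu ∧ e f = ef)) ∧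
      coeff ((CentreBlowup.step p Finset.univ la 0 B).r + (Finsupp.single la 1 + Finsupp.single mu 1 + Finsupp.single u (eu + 1) + Finsupp.single f ef))
        (CentreBlowup.step p Finset.univ la 0 B).F ≠ 0 ∧
      IsIsolated p (CentreBlowup.step p Finset.univ la 0 B).F ∧
      Module.finrank K (ResCone.resVertex (CentreBlowup.step p Finset.univ la 0 B)) = 3 := by
  have hnp : n < p := by omega
  -- (1)–(7): the regime-free core
  obtain ⟨hbmu, hrA', b', θ', e', U', E', hb'la, hb'mu, hθn, hθn', hen, hen', hu0', hf0', hdet', hU', hE', hrel', hoBp, hrBp,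
    hdivBp, hisoBp, he3Bp⟩ :=
    virtual_core_slot_sigma0 p hn hnp hlm hlu hlf hmu hmf huf hθa hθa' hea hea' hu0 hf0 hdet hU hE hrel hoA hrA hbj hstep hisoA' hcert
      hoA' he3A' hdegA' hdivA' hoB hrB hdivB hM
  -- (8) (VT): the virtual translation is zero, the virtual child is the PURE step
  have hb'0 : b' = 0 :=
    translation_eq_zero_of_frame_sigma0 p hσ hn (by omega) hlm hlu hlf hmu hmf huf hoB hrB hdivB ha hformB hb'la hb'mu hoBp he3Bp
      (fun β h6 h3 => ResCone.cInf_translation_u_eq_zero_sigma0 p hσ hn hd2 hlm hlu hlf hmu hmf huf (Or.inl rfl) hrB hoB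
        hdivB ha hformB hledB hef hN hrowB hVB h6 h3)
  rw [hb'0] at hrel' hisoBp hoBp he3Bp
  -- (9) frame propagation
  obtain ⟨hrBp0, hdivBp0, hform', hled', hrow', hV'⟩ :=
    frame_step_zero_sigma0 p hσ hn hd2 hlm hlu hlf hmu hmf huf hoB hrB hdivB ha hformB hledB hef hrowB hVB hoBp he3Bp
  exact ⟨hbmu, hrA', θ', e', U', E', hθn, hθn', hen, hen', hu0', hf0', hdet', hU', hE', hrel', hoBp, hrBp0, hdivBp0, hform', hled',
    hrow', hV', hisoBp, he3Bp⟩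

/-! ## §2 One window step, rotation case, every prime -/

/-- **ONE STEP OF THE VIRTUAL WINDOW — ROTATION CASE, every prime, unconditional.**  Virtual slots `a` (translated away by the real
step: `b (π a) ≠ 0`) and `a′` (kept), free letters `{u, f} = {g, g̃}` (`f` the contact letter of the virtual frame); the REAL chain
steps in the chart of the free letter `π g`.  The virtual partner steps PURELY in the chart of the slot `a`, and the new bijection is
`π′ = π ∘ (a g)`: `π′ a = π g`, `π′ g = π a`. [OURS] [cite: Hauser2010, §§F–G] [cite: CossartJannsenSaito2020, Thm. 3.14] -/
theorem virtual_step_rotate_sigma0 (p : ℕ) [Fact p.Prime] [CharP K p] {n d : ℕ} (hσ : n + d = p) (hn : 0 < n) (hd2 : 2 ≤ d)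
    {π : Equiv.Perm (Fin 4)} {a a' u f g gt : Fin 4} (haa' : a ≠ a') (hau : a ≠ u) (haf : a ≠ f) (ha'u : a' ≠ u) (ha'f : a' ≠ f)
    (huf : u ≠ f) (hg : (g = u ∧ gt = f) ∨ (g = f ∧ gt = u))
    -- the relation at precision `M`
    {A B : State K} {θ e : Fin 4 → MvPolynomial (Fin 4) K} {U E : MvPolynomial (Fin 4) K} {M : ℕ}
    (hθa : θ (π a) = X a * e a) (hθa' : θ (π a') = X a' * e a') (hea : constantCoeff (e a) ≠ 0)
    (hea' : constantCoeff (e a') ≠ 0) (hu0 : constantCoeff (θ (π u)) = 0) (hf0 : constantCoeff (θ (π f)) = 0)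
    (hdet : coeff (Finsupp.single u 1) (θ (π u)) * coeff (Finsupp.single f 1) (θ (π f)) -
      coeff (Finsupp.single f 1) (θ (π u)) * coeff (Finsupp.single u 1) (θ (π f)) ≠ 0)
    (hU : constantCoeff U ≠ 0) (hE : E ∈ originIdeal K ^ M) (hrel : B.F = deletePthPowers p (U ^ p * aeval θ A.F) + E)
    -- the real state and its honest rotation step
    (hoA : ordZero A.F = ((p + n : ℕ) : ℕ∞)) {A' : State K} {b : Fin 4 → K} (hbj : b (π g) = 0) (hba : b (π a) ≠ 0)
    (hba' : b (π a') = 0) (hstep : A' = CentreBlowup.step p Finset.univ (π g) b A)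
    (hisoA' : IsIsolated p A'.F) {Nc : ℕ} (hcert : originIdeal K ^ Nc ≤ singLocusIdeal p A'.F ⊔ originIdeal K ^ (Nc + 1))
    (hoA' : ordZero A'.F = ((p + n : ℕ) : ℕ∞)) (he3A' : Module.finrank K (ResCone.resVertex A') = 3)
    (hrA' : A'.r = Finsupp.single (π g) n + Finsupp.single (π a') n) (hdivA' : ∀ e ∈ A'.F.support, A'.r ≤ e)
    -- the virtual frame at jet `N`
    (hoB : ordZero B.F = ((p + n : ℕ) : ℕ∞)) (hrB : B.r = Finsupp.single a n + Finsupp.single a' n)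
    (hdivB : ∀ e ∈ B.F.support, B.r ≤ e) {aB : K} (haB : aB ≠ 0) (hformB : ResCone.resForm B = C aB * X f ^ d)
    (hledB : ∀ e ∈ B.F.support, e f ≤ d - 1 → n + 1 ≤ e a ∧ n + 1 ≤ e a') {N eu ef : ℕ} (hef : eu + ef = d - 2) (hN : p + n + 2 ≤ N)
    (hrowB : ∀ e ∈ B.F.support, e.degree < N → ¬ (e u = eu ∧ e f = ef))
    (hVB : coeff (B.r + (Finsupp.single a 1 + Finsupp.single a' 1 + Finsupp.single u (eu + 1) + Finsupp.single f ef)) B.F ≠ 0)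
    (hM : Nc + 2 * p + n + 1 ≤ M) :
    ∃ (π' : Equiv.Perm (Fin 4)) (θ' e' : Fin 4 → MvPolynomial (Fin 4) K) (U' E' : MvPolynomial (Fin 4) K),
      π' = (Equiv.swap a g).trans π ∧ π' a = π g ∧ π' a' = π a' ∧ π' g = π a ∧ π' gt = π gt ∧
      θ' (π' a) = X a * e' a ∧ θ' (π' a') = X a' * e' a' ∧ constantCoeff (e' a) ≠ 0 ∧ constantCoeff (e' a') ≠ 0 ∧
      constantCoeff (θ' (π' u)) = 0 ∧ constantCoeff (θ' (π' f)) = 0 ∧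
      coeff (Finsupp.single u 1) (θ' (π' u)) * coeff (Finsupp.single f 1) (θ' (π' f)) -
        coeff (Finsupp.single f 1) (θ' (π' u)) * coeff (Finsupp.single u 1) (θ' (π' f)) ≠ 0 ∧
      constantCoeff U' ≠ 0 ∧ E' ∈ originIdeal K ^ (M - p) ∧
      (CentreBlowup.step p Finset.univ a 0 B).F = deletePthPowers p (U' ^ p * aeval θ' A'.F) + E' ∧
      -- the frame of the virtual child at jet `N − d`
      ordZero (CentreBlowup.step p Finset.univ a 0 B).F = ((p + n : ℕ) : ℕ∞) ∧
      (CentreBlowup.step p Finset.univ a 0 B).r = Finsupp.single a n + Finsupp.single a' n ∧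
      (∀ e ∈ (CentreBlowup.step p Finset.univ a 0 B).F.support, (CentreBlowup.step p Finset.univ a 0 B).r ≤ e) ∧
      (∃ c : K, c ≠ 0 ∧ ResCone.resForm (CentreBlowup.step p Finset.univ a 0 B) = C c * X f ^ d) ∧
      (∀ e ∈ (CentreBlowup.step p Finset.univ a 0 B).F.support, e f ≤ d - 1 → n + 1 ≤ e a ∧ n + 1 ≤ e a') ∧
      (∀ e ∈ (CentreBlowup.step p Finset.univ a 0 B).F.support, e.degree < N - d → ¬ (e u = eu ∧ e f = ef)) ∧
      coeff ((CentreBlowup.step p Finset.univ a 0 B).r + (Finsupp.single a 1 + Finsupp.single a' 1 + Finsupp.single u (eu + 1) + Finsupp.single f ef))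
        (CentreBlowup.step p Finset.univ a 0 B).F ≠ 0 ∧
      IsIsolated p (CentreBlowup.step p Finset.univ a 0 B).F ∧
      Module.finrank K (ResCone.resVertex (CentreBlowup.step p Finset.univ a 0 B)) = 3 := by
  have hnp : n < p := by omega
  -- (1)–(7): the regime-free core
  obtain ⟨π', b', θ', e', U', E', hπ', hπ'a, hπ'a', hπ'g, hπ'gt, hb'a, hb'a', hθn, hθn', hen, hen', hu0', hf0', hdet', hU', hE',
    hrel', hoBp, hrBp, hdivBp, hisoBp, he3Bp⟩ :=
    virtual_core_rotate_sigma0 p hn hnp haa' hau haf ha'u ha'f huf hg hθa hθa' hea hea' hu0 hf0 hdet hU hE hrel hoA hbj hba hba'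
      hstep hisoA' hcert hoA' he3A' hrA' hdivA' hoB hrB hdivB hM
  -- (8) (VT): the virtual translation is zero, the virtual child is the PURE step
  have hb'0 : b' = 0 :=
    translation_eq_zero_of_frame_sigma0 p hσ hn (by omega) haa' hau haf ha'u ha'f huf hoB hrB hdivB haB hformB hb'a hb'a' hoBp
      he3Bp (fun β h6 h3 => ResCone.cInf_translation_u_eq_zero_sigma0 p hσ hn hd2 haa' hau haf ha'u ha'f huf (Or.inl rfl) hrB
        hoB hdivB haB hformB hledB hef hN hrowB hVB h6 h3)
  rw [hb'0] at hrel' hisoBp hoBp he3Bp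
  -- (9) frame propagation
  obtain ⟨hrBp0, hdivBp0, hform', hled', hrow', hV'⟩ :=
    frame_step_zero_sigma0 p hσ hn hd2 haa' hau haf ha'u ha'f huf hoB hrB hdivB haB hformB hledB hef hrowB hVB hoBp he3Bp
  exact ⟨π', θ', e', U', E', hπ', hπ'a, hπ'a', hπ'g, hπ'gt, hθn, hθn', hen, hen', hu0', hf0', hdet', hU', hE', hrel', hoBp, hrBp0,
    hdivBp0, hform', hled', hrow', hV', hisoBp, he3Bp⟩

end SwapTransport

end Summit.ResolutionOfSingularities.ResolutionOfSingularities.Theorems.PIDim4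

end
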